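import Summits.BirchSwinnertonDyer.BirchSwinnertonDyer.Theorems.PrintX11aLowerHalfNonSurjDoors
import Literature.NumberTheory.EllipticCurves.EmertonPollackWeston2006.WeightKMembersOddPrime
import Literature.NumberTheory.EllipticCurves.HidaFamilyMembersMultiplicativeProofs
import Literature.NumberTheory.EllipticCurves.Wuthrich2014.ThreeAdicImage
import HarnessLib

/-!
# Crux `X11aLowerHalf` (item stmt-BirchSwinnertonDyer-19064) at an ODD multiplicative prime — in particular
# `p = 3`: the Hida-family chain at ONE member with the rational cyclotomic equality DISPLAYED
# (`--supports stmt-BirchSwinnertonDyer-19064` helper; seat bsd-line-er5-p2 = -w3 width seat of the 19064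
# line, registered stub `stub_lowerThreeDeep` of line birth r3)

HONEST FRAMING. Theorems only; no definition, no named fact, no `sorry`; NO route file imported. Nothing
here closes the crux or a stub: every theorem is CONDITIONAL on displayed named facts and displayed per-pair
inputs. BSD is not proved for any curve or class by this file. beyond-print theorem: no.

## Why (the source audit at `p = 3`, held texts, page-cited)

The cell's chain for the lower half on `ClassX11a` (`X11a.forall_bsdp_of_namedFacts_ofLevel_heightFree`;
`NonSurjChain.*`, p609418 ∕ p609759 ∕ p610393) is typed at `5 ≤ p`. Of its GL₂ inputs:
* Emerton–Pollack–Weston 2006 (Thm. 3.1.1 ∕ Thm. 1 ∕ Thm. 5.1.3) is PRINTED for "an odd prime `p`"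
  (arXiv:math/0404484 p. 5); its odd-prime instances are now Literature
  (`EmertonPollackWeston2006/WeightKMembersOddPrime.lean`, p612190: `…_ofLevel_odd`);
* X. Wan, Forum Math. Sigma 3 (2015) e18, Thm. 4 = Thm. 103 (the RATIONAL cyclotomic equality for a
  good-ordinary form WITHOUT Skinner–Urban's (ram)) is PRINTED under "Suppose that `p ⩾ 5`" (p. 4, also
  Thm. 3 and the proof of Thm. 86, p. 70) — NO named fact at `p = 3` exists or is typed here;
* everything else the chain uses is typed at every odd `p` in the tree (Kato 12.4 ∕ §17.13, Greenberg 1.5,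
  Wuthrich Cor. 18 and Lemma 20, Stein–Wuthrich 6.1, Skinner 2016 §3 bridges "Throughout `p` is a fixed odd
  prime", Mazur 1978 Cor. 4.1).
So at `p = 3` the chain runs VERBATIM once Wan's conclusion AT THE MEMBER USED is carried as a displayed
hypothesis (`hRat` below) — which is what this file does, uniformly for every odd `p`.

## What

* §0 `thm311_ofLevel_of_odd`, `thm1_ofLevel_of_odd`, `thm513_ofLevel_of_odd` — the `5 ≤ p` EPW instances
  follow from the odd-prime twins (deprecate-and-add bookkeeping for p612190).
* §1 `exists_isNewform0_congr_of_multiplicative_odd`, `exists_memberOfLevel_of_exists_isNewformOf_odd`,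
  `exists_memberOfLevel_three` — a good-ordinary member of `H(E[p])` at an ODD multiplicative `p` from the
  Modularity Theorem (the tree's Deligne–Serre + `p`-old-descent proof, whose `5 ≤ p` only served
  `w = k − 2 ≥ 3`; at `p = 3`: `w = 4`, weight `6`, `E₄ ≡ 1 (mod 3)`).
* §2 `invariantsAt_normLam_of_member_of_ratEq_of_multDivisibilityAt_odd`,
  `invariantsMatchAt_of_member_of_ratEq_of_multDivisibilityAt_odd` — **the chain at ONE member, any odd
  `p`, any image**: EPW odd ×3 + Deligne–Serre ∕ Hida–Wiles data + modular parametrisation + typed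
  divisibility `X11b.MultDivisibilityAt` + certificate `μ^an(E,p) = 0` + `hRat` (the rational equality at
  the member) ⟹ EPW's invariants statement `X11a.InvariantsMatchAt W p`.
The doors to `Typed.MissingLowerBoundAt` and the class-level forms (the registered stub `stub_lowerThreeDeep`
from one `∀`-hypothesis) are in the sequel `PrintX11aLowerHalfOddPrimeDoors.lean`.

READING (for the line's lead and the planners, their call). At `p ≥ 5` the per-pair residual of the crux is
the certificate `μ^an(E,p) = 0` (Wan discharges `hRat`); at `p = 3` it is the PAIR (certificate, rational
equality at one good-ordinary member of `H(E[3])`) — and the certificate half may well become a theorem at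
`3` (the tree already proves `μ^an = 0` input-free at GOOD ordinary `3`, `AnalyticMuZeroThree.muAnZeroAt_three`),
so the `p = 3` content of `stub_lowerThreeDeep` is «Wan's Thm. 4 at `p = 3`» for one member per pair.
Skinner–Urban's Thm. 3.6.4 (typed at `3 ≤ p`, `SkinnerUrban2014.thm1_charIdeal_eq_padicLFunction_rational`)
would supply `hRat` for a member `g` of tame level `M` having a prime `q ∥ M` at which `E[3]` ramifies —
on `ClassX11a` such `q` is never a multiplicative prime of `E` (`¬ Ram`), every X11a pair at `3` is
non-semistable (tree `ram_three_of_semistable_of_irr`), and that fact carries the cell referee's flag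
`SU14-12.3.6-mu@nonsplit@3`; nothing of this is used here.

References: [EmertonPollackWeston2006] Notation p. 5, Thm. 1, Thm. 2.1.2, Thm. 3.1.1, Thm. 5.1.3, Ex. 5.3.1;
[Wan2015] Thm. 4 (p. 4) = Thm. 103 (pp. 91–92); [Kato2004Asterisque] Thm. 12.4, §17.13; [Wuthrich2014]
Thm. 3, Cor. 18, Cor. 19, Lemma 20; [Skinner2016PacificMC] §2 (odd p), §3.2–3.3; [DeligneSerreASENS1974]
6.9–6.11; [SkinnerUrban2014] Thm. 3.6.4 (reading only); cell files `pub/bsd-stepL/line-er5-p2/`,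
`pub/bsd-print-x11a/P3-EXCEPTIONAL-ZERO-ROAD.md`.
-/

set_option autoImplicit false
set_option linter.dupNamespace false -- the directory name repeats the summit name (sibling precedent)

noncomputable section

open scoped Classical MatrixGroups ModularForm

open CongruenceSubgroup UpperHalfPlane WeierstrassCurve Literature.NumberTheory.EllipticCurves
  Literature.NumberTheory.EllipticCurves.ModularForms
  Literature.NumberTheory.EllipticCurves.Rank1Residual
  Literature.NumberTheory.EllipticCurves.Rank1Residual.Typed
  Literature.NumberTheory.EllipticCurves.Wuthrich2014
  Literature.NumberTheory.EllipticCurves.SteinWuthrich2013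
  Literature.NumberTheory.EllipticCurves.Greenberg1999
  Literature.NumberTheory.EllipticCurves.Kato2004
  Literature.NumberTheory.EllipticCurves.GreenbergVatsal2000
  Literature.NumberTheory.EllipticCurves.EmertonPollackWeston2006
  Literature.NumberTheory.GaloisRepresentations
  Summit.BirchSwinnertonDyer.Rank1Residual
  Summit.BirchSwinnertonDyer.Rank1Residual.X1.MuLambda
  Summit.BirchSwinnertonDyer.Rank1Residual.X11a
  Summit.BirchSwinnertonDyer.Rank1Residual.X11a.LambdaNorm
  Summit.BirchSwinnertonDyer.Rank1Residual.X11a.Chain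

namespace Summit.BirchSwinnertonDyer.BirchSwinnertonDyer.Theorems.OddChain

/-! ### §0 Bookkeeping: the `5 ≤ p` EPW instances follow from their odd-prime twins -/

/-- The `5 ≤ p` instance `thm311_cotorsion_weightK_member_ofLevel` from its odd-prime twin
(`5 ≤ p → p ≠ 2`; deprecate-and-add bookkeeping). [cite: EmertonPollackWeston2006, Thm. 3.1.1 (arXiv:math/0404484 p. 17)] -/
theorem thm311_ofLevel_of_odd (h : thm311_cotorsion_weightK_member_ofLevel_odd) :
    thm311_cotorsion_weightK_member_ofLevel := by
  intro W _ _ p _ hp hmult hirr M _ hpM k g ι hmem 𝔇 κ γ hκ hγ D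
  exact h W p (by omega) hmult hirr hpM g ι hmem 𝔇 κ γ hκ hγ D

/-- The `5 ≤ p` instance `thm1_muAlg_of_weightK_member_ofLevel` from its odd-prime twin.
[cite: EmertonPollackWeston2006, Thm. 1 (arXiv:math/0404484 p. 2)] -/
theorem thm1_ofLevel_of_odd (h : thm1_muAlg_of_weightK_member_ofLevel_odd) :
    thm1_muAlg_of_weightK_member_ofLevel := by
  intro W _ _ p _ hp hmult hirr hμE M _ hpM k g ι hmem 𝔇 κ γ hκ hγ hγ' D htors G hG
  exact h W p (by omega) hmult hirr hμE hpM g ι hmem 𝔇 κ γ hκ hγ hγ' D htors G hG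

/-- The `5 ≤ p` instance `thm513_transfer_from_weightK_member_of_bdd_ofLevel` from its odd-prime twin.
[cite: EmertonPollackWeston2006, Thm. 5.1.3 (arXiv:math/0404484 p. 30)] -/
theorem thm513_ofLevel_of_odd (h : thm513_transfer_from_weightK_member_of_bdd_ofLevel_odd) :
    thm513_transfer_from_weightK_member_of_bdd_ofLevel := by
  intro W _ _ p _ hp hmult hirr M _ hpM k g ι hmem 𝔇 κ γ hκ hγ hγ' D htors G hG Dsym L hL hbdd hμg hlam hμan
  exact h W p (by omega) hmult hirr hpM g ι hmem 𝔇 κ γ hκ hγ hγ' D htors G hG Dsym L hL hbdd hμg hlam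
    hμan

/-! ### §1 A good-ordinary member of `H(E[p])` at an ODD multiplicative prime, from the Modularity Theorem -/

section Member

/-- An element of `ℚ̄_p` congruent to an element of norm `1` has norm `1` (the private helper of
`HidaFamilyMembersMultiplicativeProofs`, restated). [folklore] -/
private theorem norm_eq_one_of_norm_sub_lt_one' {p : ℕ} [Fact p.Prime] {x y : PadicAlgCl p}
    (hy : ‖y‖ = 1) (h : ‖x - y‖ < 1) : ‖x‖ = 1 := by
  apply le_antisymm
  · have h1 : x = (x - y) + y := by ring
    rw [h1]
    exact (PadicAlgCl.isNonarchimedean p _ _).trans (max_le h.le hy.le)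
  · by_contra hlt
    push Not at hlt
    have h1 : y = x - (x - y) := by ring
    have h2 : ‖y‖ < 1 := by
      rw [h1]
      have h3 := PadicAlgCl.isNonarchimedean p x (-(x - y))
      rw [norm_neg, ← sub_eq_add_neg] at h3
      exact h3.trans_lt (max_lt hlt h)
    rw [hy] at h2
    exact lt_irrefl _ h2

variable (W : WeierstrassCurve ℚ) [W.IsElliptic] [W.IsGloballyMinimal] (p : ℕ) [Fact p.Prime]

/-- **A classical good-ordinary member of the Hida family `H(E[p])` at an ODD multiplicative prime,
weight `2 + w` for any even `w ≥ 3` with `(p − 1) ∣ w`, level `M′ ∣ N/p`** — the tree theorem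
`exists_isNewform0_dvd_conductorNorm_div_congr_of_multiplicative_of_exists_isNewformOf`
(`HidaFamilyMembersMultiplicativeProofs`, PROVED from the Modularity Theorem: Deligne–Serre lift of
`f_E · E_w` keeping `U_p`, then `p`-old descent) with its binder `5 ≤ p` replaced by `p ≠ 2` and the
weight shift `w` made explicit — that binder served only to get `w = k − 2 ≥ 3` from
`(p − 1) ∣ (k − 2)`; at `p = 3` take `w = 4` (`E₄ ≡ 1 (mod 3)`). Proof: the same, verbatim.
-- adapted from Literature/NumberTheory/EllipticCurves/HidaFamilyMembersMultiplicativeProofs.lean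
[cite: DeligneSerreASENS1974, 6.9–6.11] [cite: EmertonPollackWeston2006, Thm. 2.1.2, §2.1 (arXiv:math/0404484 p. 7) and Ex. 5.3.1 (p. 32)]
[cite: BreuilConradDiamondTaylor2001, Thm. A] -/
theorem exists_isNewform0_congr_of_multiplicative_odd (hmod : exists_isNewformOf) (hp2 : p ≠ 2)
    (hmult : W.HasMultiplicativeReductionAtPrime p) (w : ℕ) (hw3 : 3 ≤ w) (hwe : Even w)
    (hpw : (p - 1) ∣ w) :
    ∃ (M : ℕ) (_ : NeZero M) (_ : M ∣ W.conductorNorm ℤ / p) (g : CuspForm (Gamma0 M) (2 + (w : ℤ)))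
      (ι : coeffField g →+* PadicAlgCl p),
      IsNewform0 g ∧
      ‖ι ⟨(qExpansion 1 ⇑g).coeff p, coeff_mem_coeffField g p⟩‖ = 1 ∧
      ∀ ℓ : ℕ, ℓ.Prime → ¬ ℓ ∣ W.conductorNorm ℤ →
        ‖ι ⟨(qExpansion 1 ⇑g).coeff ℓ, coeff_mem_coeffField g ℓ⟩
            - ((W.frobeniusTrace ℓ : ℤ) : PadicAlgCl p)‖ < 1 := by
  have hp : p.Prime := Fact.out
  have _ := hp2
  haveI : NeZero p := ⟨hp.ne_zero⟩
  -- `N ≠ 0`, `p ‖ N`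
  have hN0 : W.conductorNorm ℤ ≠ 0 := (W.conductorNorm_pos_holds).ne'
  haveI : NeZero (W.conductorNorm ℤ) := ⟨hN0⟩
  have hfac := W.factorization_conductorNorm_eq_one_of_hasMultiplicativeReductionAtPrime p hmult
  have hpN : p ∣ W.conductorNorm ℤ := (hp.dvd_iff_one_le_factorization hN0).mpr hfac.ge
  have hp2N : ¬ p ^ 2 ∣ W.conductorNorm ℤ := by
    intro h
    have := (hp.pow_dvd_iff_le_factorization hN0).mp h
    omega
  -- modularity: the newform `f_E`, `a_ℓ(f_E) = a_ℓ(E)` at good `ℓ`, `a_p(f_E) = ±1`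
  obtain ⟨f, hf⟩ := hmod W
  have hfℓ : ∀ (ℓ : ℕ) [Fact ℓ.Prime], W.HasGoodReductionAtPrime ℓ →
      (qExpansion 1 ⇑f).coeff ℓ = (W.frobeniusTrace ℓ : ℂ) := by
    intro ℓ _ hℓ
    rw [← WeierstrassCurve.LFunction_apply_prime_eq_frobeniusTrace W ℓ hℓ]
    exact hf.2 ℓ
  have hfp : (qExpansion 1 ⇑f).coeff p = 1 ∨ (qExpansion 1 ⇑f).coeff p = -1 := by
    by_cases hs : W.HasSplitMultiplicativeReductionAtPrime p
    · exact Or.inl (hf.cuspCoeff_eq_one_and_sq_of_split hs).1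
    · exact Or.inr (hf.cuspCoeff_eq_neg_one_and_dvd_of_nonsplit hmult hs).1
  -- an abstract field isomorphism `ℚ̄_p ≃ ℂ`
  obtain ⟨ι₀⟩ := PadicAlgCl.nonempty_ringEquiv_complex p
  have hιfp : ‖ι₀.symm ((qExpansion 1 ⇑f).coeff p)‖ = 1 := by
    rcases hfp with h | h
    · rw [h, map_one, norm_one]
    · rw [h, map_neg, map_one, norm_neg, norm_one]
  -- the Deligne–Serre eigenform of weight `2 + w` and level `N`, all `T_q` kept
  obtain ⟨F, c, hF0, hTF, hcong⟩ := exists_eigenform0_congr_of_isNewform0 ι₀ le_rfl hf.1 hw3 hwe hpw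
  -- its `U_p`-eigenvalue is a unit: `c_p ≡ a_p(f_E) = ±1`
  have hu : ‖ι₀.symm (c p)‖ = 1 := norm_eq_one_of_norm_sub_lt_one' hιfp (hcong p hp)
  -- `p`-stabilisation backwards: the newform `g` of level `M ∣ N`, `p ∤ M`
  obtain ⟨M, _, hMN, hpM, g, hgnew, hga, -, hnorm⟩ :=
    exists_isNewform0_of_ordinary_eigenform_of_exactly_dvd ι₀ hpN hp2N (by omega) hF0
      (fun q hq _ ↦ hTF q hq) (hTF p hp) hu
  -- `M ∣ N/p`
  have hMNp : M ∣ W.conductorNorm ℤ / p := by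
    have hcop : Nat.Coprime M p := (Nat.coprime_comm.mp ((hp.coprime_iff_not_dvd).mpr hpM))
    have h1 : M ∣ W.conductorNorm ℤ / p * p := by rwa [Nat.div_mul_cancel hpN]
    exact hcop.dvd_of_dvd_mul_right h1
  let ι : coeffField g →+* PadicAlgCl p :=
    (ι₀.symm : ℂ →+* PadicAlgCl p).comp (algebraMap (coeffField g) ℂ)
  have hι : ∀ (x : ℂ) (hx : x ∈ coeffField g), ι ⟨x, hx⟩ = ι₀.symm x := fun _ _ ↦ rfl
  refine ⟨M, inferInstance, hMNp, g, ι, hgnew, by rw [hι]; exact hnorm, fun ℓ hℓ hℓN ↦ ?_⟩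
  haveI : Fact ℓ.Prime := ⟨hℓ⟩
  have hgoodℓ : W.HasGoodReductionAtPrime ℓ := hasGoodReductionAtPrime_of_not_dvd_conductorNorm W hℓN
  rw [hι, hga ℓ hℓ hℓN, ← map_intCast ι₀.symm, ← hfℓ ℓ hgoodℓ]
  exact hcong ℓ hℓ

/-- **The member as an `IsOrdinaryMemberOfLevel` member at an ODD multiplicative prime** (twin of
`X11a.Chain.exists_memberOfLevel_of_exists_isNewformOf`, whose `5 ≤ p` is here `p ≠ 2`): for any
even `w ≥ 3` with `(p − 1) ∣ w` there are `M` with `p ∤ M` and an ordinary member `(g, ι)` of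
`H(E[p])` of weight `2 + w` and level `M`. At `p = 3`: `w = 4`, weight `6`.
[cite: EmertonPollackWeston2006, p. 2 (H(ρ̄)) and §2.1, Thm. 2.1.2 (arXiv:math/0404484 pp. 2, 7)]
[cite: DeligneSerreASENS1974, 6.9–6.11] [cite: BreuilConradDiamondTaylor2001, Thm. A] -/
theorem exists_memberOfLevel_of_exists_isNewformOf_odd (hNf : exists_isNewformOf) (hp2 : p ≠ 2)
    (hmult : W.HasMultiplicativeReductionAtPrime p) (w : ℕ) (hw3 : 3 ≤ w) (hwe : Even w)
    (hpw : (p - 1) ∣ w) :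
    ∃ (M : ℕ) (_ : NeZero M) (_ : ¬ p ∣ M) (g : CuspForm (Gamma0 M) (2 + (w : ℤ)))
      (ι : coeffField g →+* PadicAlgCl p), IsOrdinaryMemberOfLevel W p g ι := by
  have hp : p.Prime := Fact.out
  obtain ⟨M, instM, hM, g, ι, hg, hap, hcong⟩ :=
    exists_isNewform0_congr_of_multiplicative_odd W p hNf hp2 hmult w hw3 hwe hpw
  have hk : (2 : ℤ) < 2 + (w : ℤ) := by omega
  have hpk : ((p : ℤ) - 1) ∣ (2 + (w : ℤ) - 2) := by
    have h1 : ((p - 1 : ℕ) : ℤ) ∣ (w : ℤ) := by exact_mod_cast hpw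
    rw [Nat.cast_sub hp.one_le] at h1
    simpa using h1
  refine ⟨M, instM, fun h => not_dvd_conductorNorm_div W p hmult (h.trans hM), g, ι,
    hk, hpk, hg, hap, fun ℓ hℓ hℓNM => hcong ℓ hℓ fun h => hℓNM (dvd_mul_of_dvd_left h M)⟩

/-- **At `p = 3`**: a good-ordinary member of `H(E[3])` of weight `6` (`w = 4`: `E₄ ≡ 1 (mod 3)`) and some
level `M` with `3 ∤ M`, for every curve with multiplicative reduction at `3`, from the Modularity Theorem.
(The weight is displayed as `2 + ↑4`.) [cite: EmertonPollackWeston2006, §2.1 and Ex. 5.3.1 (arXiv:math/0404484 pp. 7, 32)]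
[cite: DeligneSerreASENS1974, 6.9–6.11] -/
theorem exists_memberOfLevel_three (hNf : exists_isNewformOf) (hp3 : p = 3)
    (hmult : W.HasMultiplicativeReductionAtPrime p) :
    ∃ (M : ℕ) (_ : NeZero M) (_ : ¬ p ∣ M) (g : CuspForm (Gamma0 M) (2 + ((4 : ℕ) : ℤ)))
      (ι : coeffField g →+* PadicAlgCl p), IsOrdinaryMemberOfLevel W p g ι :=
  exists_memberOfLevel_of_exists_isNewformOf_odd W p hNf (by omega) hmult 4 (by norm_num) (by decide)
    (by subst hp3; norm_num)

end Member

/-! ### §2 The Hida-family chain at ONE member, any ODD multiplicative prime, the rational cyclotomic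
equality at that member DISPLAYED (no Wan 2015 fact: printed `p ⩾ 5` only) -/

section Chain

variable (W : WeierstrassCurve ℚ) [W.IsElliptic] [W.IsGloballyMinimal] (p : ℕ) [Fact p.Prime]

/-- **The chain at a pair through ONE given good-ordinary member `(g, ι)` of `H(E[p])`, ANY odd
multiplicative `p`, ANY image of `ρ̄_{E,p}`** — VERBATIM the proof of
`NonSurjChain.invariantsAt_normLam_of_memberOfLevel_bdd_of_multDivisibilityAt` (p609418) with three
changes of INPUT, none of argument: (i) the member is a binder (`hpM`, `g`, `ι`, `hmem`) instead of
an existence hypothesis; (ii) the three Emerton–Pollack–Weston instances are the ODD-prime twins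
(`h311`, `hT1a`, `hT1b` : `…_odd`, Literature `WeightKMembersOddPrime.lean`; EPW fix only "an odd
prime `p`", arXiv:math/0404484 p. 5); (iii) X. Wan's Thm. 4 — printed under "`p ⩾ 5`" (Forum Math.
Sigma 3 (2015) e18, p. 4) and therefore NOT available as a named fact at `p = 3` — is replaced by the
DISPLAYED hypothesis `hRat`: its conclusion AT THIS MEMBER («`char_Λ X(ℚ_∞, A_g) = (L_p(g))` in
`Λ_𝒪 ⊗ ℚ_p`»: for all ordinary `p`-adic data, cyclotomic data, torsion dual data `D` with principal
generator `G`, Shimura datum and THE bounded cyclotomic `p`-adic `L`-function `L`: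
`L = c · (u · G)`, `c ≠ 0`, `u ∈ Λ_𝒪ˣ`). The other inputs as there: Deligne–Serre 6.1 (`h61`) and
Hida/Wiles 3.26 (`h326`) for the ordinary `p`-adic data, a modular parametrisation (`hpar`), the typed
divisibility `X11b.MultDivisibilityAt W p` (`hdiv`) and the certificate `μ^an(E,p) = 0` (`hμ`).
Conclusion: every Kato pair of `(E, p)` has unit contents and `normLam gK = normLam fE`. CONDITIONAL
on the displayed inputs; PER PAIR; closes nothing class-wide.
[cite: EmertonPollackWeston2006, p. 2 (H(ρ̄)), Notation p. 5 (odd p), Thm. 1, Thm. 3.1.1, Thm. 5.1.3]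
[cite: Wan2015, Thm. 4 (p. 4: "Suppose that p ⩾ 5") = Thm. 103 (pp. 91–92) (shape of hRat only)]
[cite: Kato2004Asterisque, §17.13 (pp. 279–280)] -/
theorem invariantsAt_normLam_of_member_of_ratEq_of_multDivisibilityAt_odd
    (h311 : thm311_cotorsion_weightK_member_ofLevel_odd) (hT1a : thm1_muAlg_of_weightK_member_ofLevel_odd)
    (hT1b : thm513_transfer_from_weightK_member_of_bdd_ofLevel_odd)
    (h61 : DeligneSerre1974.thm61_exists_adicGaloisRep) (h326 : Hida2000_thm326_ordinary)
    (hpar : nonempty_modularParametrizationData)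
    (hp2 : p ≠ 2) (hmult : W.HasMultiplicativeReductionAtPrime p)
    (hirr : W.HasIrreducibleModPGaloisRep p) (hdiv : X11b.MultDivisibilityAt W p)
    (hμ : X11a.MuAnZeroAt W p)
    {M : ℕ} [NeZero M] (hpM : ¬ p ∣ M) {k : ℤ} (g : CuspForm (Gamma0 M) k)
    (ι : coeffField g →+* PadicAlgCl p) (hmem : IsOrdinaryMemberOfLevel W p g ι)
    -- the rational cyclotomic equality AT THIS MEMBER (X. Wan 2015 Thm. 4's conclusion shape)
    (hRat : ∀ (𝔇 : OrdinaryPadicData g p ι) (κ : ZpExtension ℚ p) (γ : Field.absoluteGaloisGroup ℚ),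
        κ.IsCyclotomic → κ.IsTopGenerator γ → IsCyclotomicVariable p γ →
      ∀ (D : GreenbergSelmer.DualData (padicCoeffField (memberGenerators g ι 𝔇.υ)) κ γ 𝔇.ρ 𝔇.plus),
        Module.IsTorsion (PowerSeries (padicCoeffIntegers (memberGenerators g ι 𝔇.υ))) D.X →
      ∀ G : PowerSeries (padicCoeffIntegers (memberGenerators g ι 𝔇.υ)),
        D.charIdeal = Ideal.span {G} →
      ∀ (Dsym : PeriodSymbolDatum g) (L : PowerSeries (PadicAlgCl p)),
        IsCycPAdicLFunctionWeightK g Dsym p ι 𝔇.υ L →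
        (∃ C : ℝ, ∀ i, ‖PowerSeries.coeff i L‖ ≤ C) →
        ∃ (c : PadicAlgCl p) (u : (PowerSeries (padicCoeffIntegers (memberGenerators g ι 𝔇.υ)))ˣ),
          c ≠ 0 ∧
            L = PowerSeries.C c *
              PowerSeries.map (padicCoeffIntegers (memberGenerators g ι 𝔇.υ)).subtype
                ((u : PowerSeries (padicCoeffIntegers (memberGenerators g ι 𝔇.υ))) * G)) :
    InvariantsAt W p fun gK fE => HasUnitContent gK ∧ HasUnitContent fE ∧ normLam gK = normLam fE := by
  -- adapted from `NonSurjChain.invariantsAt_normLam_of_memberOfLevel_bdd_of_multDivisibilityAt`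
  have hprime : p.Prime := Fact.out
  haveI : NeZero p := ⟨hprime.ne_zero⟩
  -- the member: weight `k = n + 2`, `n > 0` even (`2 < k`, `(p − 1) ∣ (k − 2)`, `p` odd)
  obtain ⟨hk2, hkdvd, hg, hap, hcong⟩ := hmem
  obtain ⟨n, rfl⟩ : ∃ n : ℕ, k = (n : ℤ) + 2 := ⟨(k - 2).toNat, by omega⟩
  have hn0 : n ≠ 0 := by omega
  have hneven : Even n := by
    have h2 : (2 : ℤ) ∣ (p : ℤ) - 1 := by
      obtain ⟨m, hm⟩ := hprime.even_sub_one hp2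
      refine ⟨m, ?_⟩
      have := congrArg (fun x : ℕ => (x : ℤ)) hm
      push_cast [Nat.cast_sub hprime.one_le] at this
      linarith
    have h3 : (2 : ℤ) ∣ (n : ℤ) := by simpa using h2.trans hkdvd
    exact (Int.even_coe_nat n).mp (even_iff_two_dvd.mpr h3)
  -- (E1) the ordinary `p`-adic data; Shimura's datum; THE bounded `p`-adic `L`-function
  obtain ⟨𝔇⟩ := OrdinaryPadicData.nonempty_of_thm61_of_thm326 h61 h326 g hg (by omega) p hpM ι hap
  obtain ⟨Dsym⟩ := IsNewform0.nonempty_periodSymbolDatum hneven hn0 hg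
  obtain ⟨L, hL, hbd, -⟩ :=
    exists_isCycPAdicLFunctionWeightK_holds g hg (by omega) p hpM ι 𝔇.υ 𝔇.υ_root 𝔇.norm_υ Dsym
  -- [L4]: `μ(X(E/ℚ_∞)) = 0` for every cyclotomic / dual datum, from the certificate and `hdiv`
  have hμalg : ∀ (κ : ZpExtension ℚ p) (γ : Field.absoluteGaloisGroup ℚ), κ.IsCyclotomic →
      κ.IsTopGenerator γ → IsCyclotomicVariable p γ →
      ∀ D' : W.SelmerDualData κ γ, D'.IsTorsion ∧ D'.mu = 0 :=
    fun κ γ hκ hγ hγ' D' =>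
      NonSurjChain.isTorsion_and_mu_eq_zero_of_muAnZeroAt_of_multDivisibilityAt W p hpar hmult hdiv hμ
        hκ hγ hγ' D'
  -- restore the member predicate for the EPW instances
  have hmem' : IsOrdinaryMemberOfLevel W p g ι := ⟨hk2, hkdvd, hg, hap, hcong⟩
  -- the conclusion's own cyclotomic datum serves the `g`-side
  intro κ γ hκ hγ hγ' N _ f hf D' ϖ hϖ fE gK hchar
  -- (E2) the dual datum; EPW Thm. 3.1.1 (cotorsion); (E3) a principal generator
  obtain ⟨D⟩ := GreenbergSelmer.nonempty_dualData (memberGenerators g ι 𝔇.υ) κ hγ 𝔇.ρ 𝔇.plus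
  obtain ⟨hfin, htors⟩ := h311 W p hp2 hmult hirr hpM g ι hmem' 𝔇 κ γ hκ hγ D
  haveI : FiniteDimensional ℚ_[p] (padicCoeffField (memberGenerators g ι 𝔇.υ)) :=
    finiteDimensional_padicCoeffField_memberGenerators hg ι 𝔇.υ
  obtain ⟨G, hG⟩ :=
    (GreenbergSelmer.DualData.isPrincipal_charIdeal (memberGenerators g ι 𝔇.υ) D).principal
  -- EPW Thm. 1 (alg): `μ^alg(g) = 0`
  have hμg := hT1a W p hp2 hmult hirr hμalg hpM g ι hmem' 𝔇 κ γ hκ hγ hγ' D htors G hG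
  -- the displayed rational equality at the member: `L = c · u · G`, hence `λ^alg(g) = λ^an(g)`
  obtain ⟨c, u, hc, hLcuG⟩ := hRat 𝔇 κ γ hκ hγ hγ' D htors G hG Dsym L hL hbd
  have hlam : normLam (PowerSeries.map (padicCoeffIntegers (memberGenerators g ι 𝔇.υ)).subtype G) =
      normLam L := by
    obtain ⟨hU0, hU⟩ := map_unit_integral u
    obtain ⟨hGmax, hG0⟩ := hasMaxCoeff_map_of_exists_norm_eq_one hμg
    rw [hLcuG, normLam_C_mul (norm_ne_zero_iff.mpr hc), map_mul,
      normLam_mul_of_integral_unit hU0 hU hGmax hG0]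
  -- EPW Thm. 5.1.3 (+ 4.4.5 with the certificate), at the Kato pair
  exact hT1b W p hp2 hmult hirr hpM g ι hmem' 𝔇 κ γ hκ hγ hγ' D htors G hG Dsym L hL hbd hμg hlam hμ κ
    γ hκ hγ hγ' f hf D' ϖ hϖ fE gK hchar

/-- **EPW's invariants statement `X11a.InvariantsMatchAt W p` at ANY odd multiplicative `p` with
`E[p]` irreducible (any image), from ONE member with the displayed rational equality, the typed
divisibility, the certificate and the odd-prime EPW facts** (`invariantsMatchAt_of_invariantsAt_normLam` ∘ §2).
[cite: EmertonPollackWeston2006, Thm. 1, Thm. 3.1.1, Thm. 5.1.3, Def. 4.4.6] -/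
theorem invariantsMatchAt_of_member_of_ratEq_of_multDivisibilityAt_odd
    (h311 : thm311_cotorsion_weightK_member_ofLevel_odd) (hT1a : thm1_muAlg_of_weightK_member_ofLevel_odd)
    (hT1b : thm513_transfer_from_weightK_member_of_bdd_ofLevel_odd)
    (h61 : DeligneSerre1974.thm61_exists_adicGaloisRep) (h326 : Hida2000_thm326_ordinary)
    (hpar : nonempty_modularParametrizationData)
    (hp2 : p ≠ 2) (hmult : W.HasMultiplicativeReductionAtPrime p)
    (hirr : W.HasIrreducibleModPGaloisRep p) (hdiv : X11b.MultDivisibilityAt W p)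
    (hμ : X11a.MuAnZeroAt W p)
    {M : ℕ} [NeZero M] (hpM : ¬ p ∣ M) {k : ℤ} (g : CuspForm (Gamma0 M) k)
    (ι : coeffField g →+* PadicAlgCl p) (hmem : IsOrdinaryMemberOfLevel W p g ι)
    (hRat : ∀ (𝔇 : OrdinaryPadicData g p ι) (κ : ZpExtension ℚ p) (γ : Field.absoluteGaloisGroup ℚ),
        κ.IsCyclotomic → κ.IsTopGenerator γ → IsCyclotomicVariable p γ →
      ∀ (D : GreenbergSelmer.DualData (padicCoeffField (memberGenerators g ι 𝔇.υ)) κ γ 𝔇.ρ 𝔇.plus),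
        Module.IsTorsion (PowerSeries (padicCoeffIntegers (memberGenerators g ι 𝔇.υ))) D.X →
      ∀ G : PowerSeries (padicCoeffIntegers (memberGenerators g ι 𝔇.υ)),
        D.charIdeal = Ideal.span {G} →
      ∀ (Dsym : PeriodSymbolDatum g) (L : PowerSeries (PadicAlgCl p)),
        IsCycPAdicLFunctionWeightK g Dsym p ι 𝔇.υ L →
        (∃ C : ℝ, ∀ i, ‖PowerSeries.coeff i L‖ ≤ C) →
        ∃ (c : PadicAlgCl p) (u : (PowerSeries (padicCoeffIntegers (memberGenerators g ι 𝔇.υ)))ˣ),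
          c ≠ 0 ∧
            L = PowerSeries.C c *
              PowerSeries.map (padicCoeffIntegers (memberGenerators g ι 𝔇.υ)).subtype
                ((u : PowerSeries (padicCoeffIntegers (memberGenerators g ι 𝔇.υ))) * G)) :
    InvariantsMatchAt W p :=
  invariantsMatchAt_of_invariantsAt_normLam W p
    (invariantsAt_normLam_of_member_of_ratEq_of_multDivisibilityAt_odd W p h311 hT1a hT1b h61 h326 hpar
      hp2 hmult hirr hdiv hμ hpM g ι hmem hRat)

end Chain

end Summit.BirchSwinnertonDyer.BirchSwinnertonDyer.Theorems.OddChain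

end
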